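import Summits.QuantumFields.YangMills.Theorems.ScalingWindowSplitSelfNormalisedSkewnessWitnessPerSiteBox
import Summits.QuantumFields.YangMills.Theorems.ScalingWindowSplitSelfNormalisedSkewnessWitnessLargeField
import Summits.QuantumFields.YangMills.Theorems.ScalingWindowSplitSelfNormalisedSkewnessWitnessCumulants
import HarnessLib

/-!
# `SelfNormalisedSkewness` — negative side: per-site cumulants under Wilson's `U(1)` measure

Route `ScalingWindowSplit`, crux `stmt-QuantumFields-18944`, line `Sketch` (negation branch), support for the
lead's `stub_witnessAssembly`.  We transfer the per-site cumulant formulas of `WitnessPerSiteBox` from the box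
probability to Wilson's measure `μ_β` through the moment dictionary of `WitnessBoxMeasure`: for the plaquette
observable `Fsite x U = Σ_q cos ω_{(x,q)}(U)` (the curvature species of the `U(1)` witness at the site `x`),
`κ₃^{μ_β}(Fsite x, Fsite y, Fsite z) = −β⁻³ ring(x,y,z) + O(μ_β(G_εᶜ) + ε⁸ + β⁻³ξ)` and
`Cov^{μ_β}(Fsite x, Fsite y) = β⁻²/2 Σ πK(x−y)² + O(μ_β(G_εᶜ) + ε⁶ + β⁻²ξ)` with a universal constant.

References: Lüscher 1999 §3; standard.  No definitions of propositions, no named facts.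
-/

noncomputable section

open scoped BigOperators ENNReal InnerProductSpace
open MeasureTheory ProbabilityTheory
open Literature.MathematicalPhysics.QuantumLattice Literature.MathematicalPhysics.QuantumFieldTheory
open Literature.Probability.LatticeModels (TorusSite torusGreen)
open Summit.QuantumFields.YangMills.Theorems.CurvatureBoostCovariance.Negative (card_planes)

namespace Summit.QuantumFields.YangMills.Theorems.SelfNormalisedSkewness.Negative

variable {S : ℕ} [NeZero S]

/-- The per-site plaquette observable of the `U(1)` witness: `Σ_q cos ω_{(x,q)}(U)`. [folklore] -/
def Fsite (x : Site 4 S) (U : GaugeConfig 4 S Circle) : ℝ :=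
  ∑ q : {q : Fin 4 × Fin 4 // q.1 < q.2}, Real.cos (abelianFieldTensor U x q.1.1 q.1.2)

omit [NeZero S] in
/-- `Fsite` is measurable. [folklore] -/
theorem measurable_Fsite (x : Site 4 S) : Measurable (Fsite (S := S) x) :=
  Finset.measurable_sum _ fun q _ => Real.measurable_cos.comp (measurable_abelianFieldTensor x q.1.1 q.1.2)

omit [NeZero S] in
/-- `|Fsite x| ≤ 6`. [folklore] -/
theorem abs_Fsite_le (x : Site 4 S) (U : GaugeConfig 4 S Circle) : |Fsite x U| ≤ 6 := by
  unfold Fsite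
  refine (Finset.abs_sum_le_sum_abs _ _).trans ?_
  calc ∑ q : {q : Fin 4 × Fin 4 // q.1 < q.2}, |Real.cos (abelianFieldTensor U x q.1.1 q.1.2)|
      ≤ ∑ _q : {q : Fin 4 × Fin 4 // q.1 < q.2}, (1 : ℝ) := Finset.sum_le_sum fun q _ => Real.abs_cos_le_one _
    _ = 6 := by simp [card_planes]

/-- On the good set, `Fsite x` is `cosSite x` read through the chart `ω`. [folklore] -/
theorem Fsite_eq_cosSite_omegaV {ε : ℝ} (hSε : (S : ℝ) ^ 4 * ε ≤ 2 * Real.pi) (h6 : 6 * ε ≤ 2 * Real.pi)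
    {U : GaugeConfig 4 S Circle} (hU : ∀ p : Plaquette 4 S, |plaqAngle U p| < ε) (x : Site 4 S) :
    Fsite x U = cosSite x (omegaV U) := by
  have hmem := plaqAngle_mem_range_of_small (S := S)
    (fun S _ ω h1 h2 h3 => stub_torusTwoFormExact S ω h1 h2 h3) hSε h6 U hU
  unfold Fsite cosSite
  refine Finset.sum_congr rfl fun q _ => ?_
  rw [inner_frameV, omegaV_of_mem hmem]
  rfl

omit [NeZero S] in
/-- The good set's complement is the large-plaquette event of `WitnessLargeField`. [folklore] -/
theorem compl_goodSet_eq (ε : ℝ) :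
    {U : GaugeConfig 4 S Circle | ∀ p : Plaquette 4 S, |plaqAngle U p| < ε}ᶜ =
      {U : GaugeConfig 4 S Circle | ∃ p : Plaquette 4 S, ε ≤ |abelianFieldTensor U p.1 p.2.1.1 p.2.1.2|} := by
  ext U
  simp only [Set.mem_compl_iff, Set.mem_setOf_eq, not_forall, not_lt, plaqAngle_apply]

/-- **Raw-moment dictionary for the per-site observables**: the mixed moments of `Fsite` under `μ_β` and of
`cosSite` under `boxProb` differ by at most `2·6ᵐ·μ_β(G_εᶜ)`. [folklore] -/
theorem site_moments_transfer {ε β : ℝ} (hε : 0 < ε) (hβ : 0 ≤ β) (hεπ : ε ≤ Real.pi)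
    (hSε : (S : ℝ) ^ 4 * ε ≤ 2 * Real.pi) (h6 : 6 * ε ≤ 2 * Real.pi) (x y z : Site 4 S) :
    |∫ U, Fsite x U ∂(wilsonMeasure u1Rep β : Measure (GaugeConfig 4 S Circle)) -
        ∫ v, cosSite x v ∂(boxProb S β ε)| ≤ 2 * 6 *
      (wilsonMeasure u1Rep β : Measure (GaugeConfig 4 S Circle)).real
        {U : GaugeConfig 4 S Circle | ∀ p : Plaquette 4 S, |plaqAngle U p| < ε}ᶜ ∧
    |∫ U, Fsite x U * Fsite y U ∂(wilsonMeasure u1Rep β : Measure (GaugeConfig 4 S Circle)) -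
        ∫ v, cosSite x v * cosSite y v ∂(boxProb S β ε)| ≤ 2 * 36 *
      (wilsonMeasure u1Rep β : Measure (GaugeConfig 4 S Circle)).real
        {U : GaugeConfig 4 S Circle | ∀ p : Plaquette 4 S, |plaqAngle U p| < ε}ᶜ ∧
    |∫ U, Fsite x U * Fsite y U * Fsite z U ∂(wilsonMeasure u1Rep β : Measure (GaugeConfig 4 S Circle)) -
        ∫ v, cosSite x v * cosSite y v * cosSite z v ∂(boxProb S β ε)| ≤ 2 * 216 *
      (wilsonMeasure u1Rep β : Measure (GaugeConfig 4 S Circle)).real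
        {U : GaugeConfig 4 S Circle | ∀ p : Plaquette 4 S, |plaqAngle U p| < ε}ᶜ := by
  have hm := measurable_Fsite (S := S)
  have hc := measurable_cosSite (S := S)
  have b1 := abs_Fsite_le (S := S)
  have c1 := abs_cosSite_le (S := S)
  have b2 : ∀ (x y : Site 4 S) (U : GaugeConfig 4 S Circle), |Fsite x U * Fsite y U| ≤ 36 := fun x y U => by
    rw [abs_mul]; nlinarith [b1 x U, b1 y U, abs_nonneg (Fsite x U), abs_nonneg (Fsite y U)]
  have c2 : ∀ (x y : Site 4 S) (v : LinearMap.range (plaqCoboundary S)), |cosSite x v * cosSite y v| ≤ 36 :=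
    fun x y v => by
    rw [abs_mul]; nlinarith [c1 x v, c1 y v, abs_nonneg (cosSite x v), abs_nonneg (cosSite y v)]
  have b3 : ∀ U : GaugeConfig 4 S Circle, |Fsite x U * Fsite y U * Fsite z U| ≤ 216 := fun U => by
    rw [abs_mul]; nlinarith [b2 x y U, b1 z U, abs_nonneg (Fsite x U * Fsite y U), abs_nonneg (Fsite z U)]
  have c3 : ∀ v : LinearMap.range (plaqCoboundary S), |cosSite x v * cosSite y v * cosSite z v| ≤ 216 :=
    fun v => by
    rw [abs_mul]
    nlinarith [c2 x y v, c1 z v, abs_nonneg (cosSite x v * cosSite y v), abs_nonneg (cosSite z v)]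
  have hag : ∀ (x : Site 4 S) (U : GaugeConfig 4 S Circle), (∀ p : Plaquette 4 S, |plaqAngle U p| < ε) →
      Fsite x U = cosSite x (omegaV U) := fun x U hU => Fsite_eq_cosSite_omegaV hSε h6 hU x
  refine ⟨abs_integral_sub_integral_boxProb_le hε hβ hεπ hSε h6 (hm x) (hc x) (b1 x) (c1 x) (hag x),
    abs_integral_sub_integral_boxProb_le hε hβ hεπ hSε h6 ((hm x).mul (hm y)) ((hc x).mul (hc y)) (b2 x y)
      (c2 x y) fun U hU => by
        show Fsite x U * Fsite y U = cosSite x (omegaV U) * cosSite y (omegaV U)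
        rw [hag x U hU, hag y U hU],
    abs_integral_sub_integral_boxProb_le hε hβ hεπ hSε h6 (((hm x).mul (hm y)).mul (hm z))
      (((hc x).mul (hc y)).mul (hc z)) b3 c3 fun U hU => by
        show Fsite x U * Fsite y U * Fsite z U = cosSite x (omegaV U) * cosSite y (omegaV U) * cosSite z (omegaV U)
        rw [hag x U hU, hag y U hU, hag z U hU]⟩

/-- **Cumulant dictionary for the per-site observables**: third and second central moments of `Fsite` under
`μ_β` and of `cosSite` under `boxProb` differ by `O(μ_β(G_εᶜ))` (universal constants). [folklore] -/
theorem site_cumulants_transfer {ε β : ℝ} (hε : 0 < ε) (hβ : 0 ≤ β) (hεπ : ε ≤ Real.pi)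
    (hSε : (S : ℝ) ^ 4 * ε ≤ 2 * Real.pi) (h6 : 6 * ε ≤ 2 * Real.pi) (x y z : Site 4 S) :
    |cm3 (wilsonMeasure u1Rep β : Measure (GaugeConfig 4 S Circle)) (Fsite x) (Fsite y) (Fsite z) -
        cm3 (boxProb S β ε) (cosSite x) (cosSite y) (cosSite z)| ≤
      (432 + 6 * 432 * (216 + 2 * 432) + 6 * 432 * (216 + 2 * 432) ^ 2) *
        (wilsonMeasure u1Rep β : Measure (GaugeConfig 4 S Circle)).real
          {U : GaugeConfig 4 S Circle | ∀ p : Plaquette 4 S, |plaqAngle U p| < ε}ᶜ ∧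
    |cm2 (wilsonMeasure u1Rep β : Measure (GaugeConfig 4 S Circle)) (Fsite x) (Fsite y) -
        cm2 (boxProb S β ε) (cosSite x) (cosSite y)| ≤
      (432 + 2 * 432 * (216 + 2 * 432)) *
        (wilsonMeasure u1Rep β : Measure (GaugeConfig 4 S Circle)).real
          {U : GaugeConfig 4 S Circle | ∀ p : Plaquette 4 S, |plaqAngle U p| < ε}ᶜ := by
  set μ : Measure (GaugeConfig 4 S Circle) := wilsonMeasure u1Rep β
  haveI : IsProbabilityMeasure μ := isProbabilityMeasure_wilsonMeasure (L := S) u1Rep continuous_u1Rep β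
  haveI := isProbabilityMeasure_boxProb (S := S) hβ hε
  set η := μ.real {U : GaugeConfig 4 S Circle | ∀ p : Plaquette 4 S, |plaqAngle U p| < ε}ᶜ with hη
  have hη0 : 0 ≤ η := measureReal_nonneg
  have hη1 : η ≤ 2 := (measureReal_le_one (μ := μ)).trans one_le_two
  -- integrability (bounded observables on probability spaces)
  have hm := measurable_Fsite (S := S)
  have hc := measurable_cosSite (S := S)
  have b1 := abs_Fsite_le (S := S)
  have c1 := abs_cosSite_le (S := S)
  have b2 : ∀ (x y : Site 4 S) (U : GaugeConfig 4 S Circle), |Fsite x U * Fsite y U| ≤ 36 := fun x y U => by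
    rw [abs_mul]; nlinarith [b1 x U, b1 y U, abs_nonneg (Fsite x U), abs_nonneg (Fsite y U)]
  have c2 : ∀ (x y : Site 4 S) (v : LinearMap.range (plaqCoboundary S)), |cosSite x v * cosSite y v| ≤ 36 :=
    fun x y v => by
    rw [abs_mul]; nlinarith [c1 x v, c1 y v, abs_nonneg (cosSite x v), abs_nonneg (cosSite y v)]
  have b3 : ∀ (x y z : Site 4 S) (U : GaugeConfig 4 S Circle), |Fsite x U * Fsite y U * Fsite z U| ≤ 216 :=
    fun x y z U => by
    rw [abs_mul]; nlinarith [b2 x y U, b1 z U, abs_nonneg (Fsite x U * Fsite y U), abs_nonneg (Fsite z U)]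
  have c3 : ∀ (x y z : Site 4 S) (v : LinearMap.range (plaqCoboundary S)),
      |cosSite x v * cosSite y v * cosSite z v| ≤ 216 := fun x y z v => by
    rw [abs_mul]
    nlinarith [c2 x y v, c1 z v, abs_nonneg (cosSite x v * cosSite y v), abs_nonneg (cosSite z v)]
  have iF1 : ∀ x, Integrable (Fsite x) μ := fun x => integrable_of_abs_le_const (hm x) (b1 x)
  have iF2 : ∀ x y, Integrable (fun U => Fsite x U * Fsite y U) μ := fun x y =>
    integrable_of_abs_le_const ((hm x).mul (hm y)) (b2 x y)
  have iF3 : ∀ x y z, Integrable (fun U => Fsite x U * Fsite y U * Fsite z U) μ := fun x y z =>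
    integrable_of_abs_le_const (((hm x).mul (hm y)).mul (hm z)) (b3 x y z)
  have iC1 : ∀ x, Integrable (cosSite x) (boxProb S β ε) := fun x => integrable_of_abs_le_const (hc x) (c1 x)
  have iC2 : ∀ x y, Integrable (fun v => cosSite x v * cosSite y v) (boxProb S β ε) := fun x y =>
    integrable_of_abs_le_const ((hc x).mul (hc y)) (c2 x y)
  have iC3 : ∀ x y z, Integrable (fun v => cosSite x v * cosSite y v * cosSite z v) (boxProb S β ε) :=
    fun x y z => integrable_of_abs_le_const (((hc x).mul (hc y)).mul (hc z)) (c3 x y z)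
  -- raw moments agree up to O(η)
  obtain ⟨d1x, d2xy, d3⟩ := site_moments_transfer (S := S) hε hβ hεπ hSε h6 x y z
  obtain ⟨d1y, d2yz, -⟩ := site_moments_transfer (S := S) hε hβ hεπ hSε h6 y z x
  obtain ⟨d1z, -, -⟩ := site_moments_transfer (S := S) hε hβ hεπ hSε h6 z x y
  obtain ⟨-, d2xz, -⟩ := site_moments_transfer (S := S) hε hβ hεπ hSε h6 x z y
  -- sizes of the box moments
  have k1 : ∀ x, |∫ v, cosSite x v ∂(boxProb S β ε)| ≤ 216 := fun x => by
    have h := norm_integral_le_of_norm_le_const (μ := boxProb S β ε) (C := 6)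
      (ae_of_all _ fun v => show ‖cosSite x v‖ ≤ 6 by rw [Real.norm_eq_abs]; exact c1 x v)
    rw [Real.norm_eq_abs, probReal_univ, mul_one] at h
    linarith
  have k2 : ∀ x y, |∫ v, cosSite x v * cosSite y v ∂(boxProb S β ε)| ≤ 216 := fun x y => by
    have h := norm_integral_le_of_norm_le_const (μ := boxProb S β ε) (C := 36)
      (ae_of_all _ fun v => show ‖cosSite x v * cosSite y v‖ ≤ 36 by rw [Real.norm_eq_abs]; exact c2 x y v)
    rw [Real.norm_eq_abs, probReal_univ, mul_one] at h
    linarith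
  -- error normalisation: 2·6ᵐ·η ≤ 432·1ᵐ·η
  have e1 : ∀ {a : ℝ}, |a| ≤ 2 * 6 * η → |a| ≤ 432 * 1 * η := fun h => h.trans (by nlinarith)
  have e2 : ∀ {a : ℝ}, |a| ≤ 2 * 36 * η → |a| ≤ 432 * 1 ^ 2 * η := fun h => h.trans (by nlinarith)
  have e3 : ∀ {a : ℝ}, |a| ≤ 2 * 216 * η → |a| ≤ 432 * 1 ^ 3 * η := fun h => h.trans (by nlinarith)
  constructor
  · have tr := cubic_transfer (b := 1) (ξ := η) (C := 432) (C₂ := 216) zero_le_one hη0 hη1 (by norm_num)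
      (by norm_num)
      (m1x := ∫ U, Fsite x U ∂μ) (m1y := ∫ U, Fsite y U ∂μ) (m1z := ∫ U, Fsite z U ∂μ)
      (m2yz := ∫ U, Fsite y U * Fsite z U ∂μ) (m2xz := ∫ U, Fsite x U * Fsite z U ∂μ)
      (m2xy := ∫ U, Fsite x U * Fsite y U ∂μ) (m3 := ∫ U, Fsite x U * Fsite y U * Fsite z U ∂μ)
      (g1x := ∫ v, cosSite x v ∂(boxProb S β ε)) (g1y := ∫ v, cosSite y v ∂(boxProb S β ε))
      (g1z := ∫ v, cosSite z v ∂(boxProb S β ε))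
      (g2yz := ∫ v, cosSite y v * cosSite z v ∂(boxProb S β ε))
      (g2xz := ∫ v, cosSite x v * cosSite z v ∂(boxProb S β ε))
      (g2xy := ∫ v, cosSite x v * cosSite y v ∂(boxProb S β ε))
      (g3 := ∫ v, cosSite x v * cosSite y v * cosSite z v ∂(boxProb S β ε))
      (e1 (by simpa only [one_mul] using d1x)) (e1 (by simpa only [one_mul] using d1y))
      (e1 (by simpa only [one_mul] using d1z)) (e2 (by simpa only [one_pow, one_mul] using d2yz))
      (e2 (by simpa only [one_pow, one_mul] using d2xz)) (e2 (by simpa only [one_pow, one_mul] using d2xy))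
      (e3 (by simpa only [one_pow, one_mul] using d3)) (k1 x) (k1 y) (k1 z) (k2 y z) (k2 x z) (k2 x y)
    rw [← cm3_eq_poly (iF1 x) (iF1 y) (iF1 z) (iF2 x y) (iF2 x z) (iF2 y z) (iF3 x y z), one_pow, one_mul,
      ← cm3_eq_poly (iC1 x) (iC1 y) (iC1 z) (iC2 x y) (iC2 x z) (iC2 y z) (iC3 x y z), mul_one] at tr
    exact tr
  · have tr := quadratic_transfer (b := 1) (ξ := η) (C := 432) (C₂ := 216) zero_le_one hη0 hη1 (by norm_num)
      (by norm_num)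
      (m1x := ∫ U, Fsite x U ∂μ) (m1y := ∫ U, Fsite y U ∂μ) (m2xy := ∫ U, Fsite x U * Fsite y U ∂μ)
      (g1x := ∫ v, cosSite x v ∂(boxProb S β ε)) (g1y := ∫ v, cosSite y v ∂(boxProb S β ε))
      (g2xy := ∫ v, cosSite x v * cosSite y v ∂(boxProb S β ε))
      (e1 (by simpa only [one_mul] using d1x)) (e1 (by simpa only [one_mul] using d1y))
      (e2 (by simpa only [one_pow, one_mul] using d2xy)) (k1 x) (k1 y)
    rw [← cm2_eq_poly (iF1 x) (iF1 y) (iF2 x y), one_pow, one_mul, ← cm2_eq_poly (iC1 x) (iC1 y) (iC2 x y),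
      mul_one] at tr
    exact tr


/-- **Per-site cumulants under Wilson's `U(1)` measure.**  Universal `C` such that for all `S`, `β > 0`,
admissible small `ε` (as in `box_cumulants`, plus `S⁴ε ≤ 2π`) and all sites:
`|κ₃^{μ_β}(Fsite x, Fsite y, Fsite z) + β⁻³ ring| ≤ C μ_β(G_εᶜ) + 10 ε⁸ + C β⁻³ ξ` and
`|Cov^{μ_β}(Fsite x, Fsite y) − β⁻²/2 Σ πK²| ≤ C μ_β(G_εᶜ) + 10 ε⁶ + C β⁻² ξ`. [folklore] -/
theorem site_cumulants : ∃ C : ℝ, 0 < C ∧ ∀ (S : ℕ) [NeZero S] (β ε : ℝ), 0 < β → 0 < ε → ε ≤ 1 →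
    ε ≤ Real.pi → (S : ℝ) ^ 4 * ε ≤ 2 * Real.pi → 6 * ε ≤ 2 * Real.pi →
    1 ≤ ε * Real.sqrt β → β * Fintype.card (Plaquette 4 S) * ε ^ 4 ≤ 1 →
    Fintype.card (Plaquette 4 S) * (ε * Real.sqrt β)⁻¹ ^ 6 ≤ 1 →
    (stdGaussian (LinearMap.range (plaqCoboundary S))).real
        {w | ∃ p, ε * Real.sqrt β ≤ |⟪frameV S p, w⟫_ℝ|} ≤ 1 / 2 →
    ∀ (x y z : Site 4 S),
    |cm3 (wilsonMeasure u1Rep β : Measure (GaugeConfig 4 S Circle)) (Fsite x) (Fsite y) (Fsite z) +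
        β⁻¹ ^ 3 * ∑ α, ∑ α', ∑ α'', maxwellK S (x - y) α α' * maxwellK S (y - z) α' α'' * maxwellK S (z - x) α'' α| ≤
      C * (wilsonMeasure u1Rep β : Measure (GaugeConfig 4 S Circle)).real
          {U : GaugeConfig 4 S Circle | ∀ p : Plaquette 4 S, |plaqAngle U p| < ε}ᶜ +
        10 * ε ^ 8 + C * β⁻¹ ^ 3 *
          (β * Fintype.card (Plaquette 4 S) * ε ^ 4 + Fintype.card (Plaquette 4 S) * (ε * Real.sqrt β)⁻¹ ^ 6) ∧
    |cm2 (wilsonMeasure u1Rep β : Measure (GaugeConfig 4 S Circle)) (Fsite x) (Fsite y) -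
        β⁻¹ ^ 2 / 2 * ∑ α, ∑ α', maxwellK S (x - y) α α' ^ 2| ≤
      C * (wilsonMeasure u1Rep β : Measure (GaugeConfig 4 S Circle)).real
          {U : GaugeConfig 4 S Circle | ∀ p : Plaquette 4 S, |plaqAngle U p| < ε}ᶜ +
        10 * ε ^ 6 + C * β⁻¹ ^ 2 *
          (β * Fintype.card (Plaquette 4 S) * ε ^ 4 + Fintype.card (Plaquette 4 S) * (ε * Real.sqrt β)⁻¹ ^ 6) := by
  obtain ⟨Cb, hCb0, hbox⟩ := box_cumulants
  refine ⟨max (432 + 6 * 432 * (216 + 2 * 432) + 6 * 432 * (216 + 2 * 432) ^ 2) Cb, lt_max_of_lt_right hCb0,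
    fun S _ β ε hβ hε hε1 hεπ hSε h6 ht hw hτ htail x y z => ?_⟩
  obtain ⟨t3, t2⟩ := site_cumulants_transfer (S := S) hε hβ.le hεπ hSε h6 x y z
  obtain ⟨b3, b2⟩ := hbox S β ε hβ hε hε1 ht hw hτ htail x y z
  have hη0 : 0 ≤ (wilsonMeasure u1Rep β : Measure (GaugeConfig 4 S Circle)).real
      {U : GaugeConfig 4 S Circle | ∀ p : Plaquette 4 S, |plaqAngle U p| < ε}ᶜ := measureReal_nonneg
  have hξ0 : 0 ≤ β * Fintype.card (Plaquette 4 S) * ε ^ 4 +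
      Fintype.card (Plaquette 4 S) * (ε * Real.sqrt β)⁻¹ ^ 6 := by positivity
  have hb : 0 ≤ β⁻¹ := inv_nonneg.2 hβ.le
  have hK₂ : (432 + 2 * 432 * (216 + 2 * 432) : ℝ) ≤
      432 + 6 * 432 * (216 + 2 * 432) + 6 * 432 * (216 + 2 * 432) ^ 2 := by norm_num
  have key : ∀ (A B R : ℝ), |A + R| ≤ |A - B| + |B + R| := fun A B R => by
    have h := abs_add_le (A - B) (B + R)
    rwa [show A - B + (B + R) = A + R by ring] at h
  constructor
  · have := key (cm3 (wilsonMeasure u1Rep β : Measure (GaugeConfig 4 S Circle)) (Fsite x) (Fsite y) (Fsite z))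
      (cm3 (boxProb S β ε) (cosSite x) (cosSite y) (cosSite z))
      (β⁻¹ ^ 3 * ∑ α, ∑ α', ∑ α'', maxwellK S (x - y) α α' * maxwellK S (y - z) α' α'' * maxwellK S (z - x) α'' α)
    have m1 := mul_le_mul_of_nonneg_right
      (le_max_left (432 + 6 * 432 * (216 + 2 * 432) + 6 * 432 * (216 + 2 * 432) ^ 2 : ℝ) Cb) hη0
    have m2 := mul_le_mul_of_nonneg_right (mul_le_mul_of_nonneg_right
      (le_max_right (432 + 6 * 432 * (216 + 2 * 432) + 6 * 432 * (216 + 2 * 432) ^ 2 : ℝ) Cb)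
      (pow_nonneg hb 3)) hξ0
    exact this.trans ((add_le_add t3 b3).trans ((add_le_add m1 (add_le_add le_rfl m2)).trans_eq (by ring)))
  · have := abs_sub_le (cm2 (wilsonMeasure u1Rep β : Measure (GaugeConfig 4 S Circle)) (Fsite x) (Fsite y))
      (cm2 (boxProb S β ε) (cosSite x) (cosSite y)) (β⁻¹ ^ 2 / 2 * ∑ α, ∑ α', maxwellK S (x - y) α α' ^ 2)
    have m1 := mul_le_mul_of_nonneg_right
      (hK₂.trans (le_max_left (432 + 6 * 432 * (216 + 2 * 432) + 6 * 432 * (216 + 2 * 432) ^ 2 : ℝ) Cb)) hη0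
    have m2 := mul_le_mul_of_nonneg_right (mul_le_mul_of_nonneg_right
      (le_max_right (432 + 6 * 432 * (216 + 2 * 432) + 6 * 432 * (216 + 2 * 432) ^ 2 : ℝ) Cb)
      (pow_nonneg hb 2)) hξ0
    exact this.trans ((add_le_add t2 b2).trans ((add_le_add m1 (add_le_add le_rfl m2)).trans_eq (by ring)))

end Summit.QuantumFields.YangMills.Theorems.SelfNormalisedSkewness.Negative

end
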